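import Summits.Ventures.PercRepro.ExcessOneNoPartnerPairSetup

/-!
# Theorem (MA-i, no K–K pair), part II: every partner member meets `x`, and `x` completes `F`

Setting of `ExcessOneNoPartnerPairSetup` (Addendum 26): a `(P₀, K)` witness `x, insert b x`
without `K`–`K` `b`-pairs, `∅ ∉ F`, `{b} ∉ F`. A partner member `k` disjoint from `x` would force
`K_b = {insert b x}` (`partner_mem_b_cases`) and the count
`Y = (K \ {insert b x}) \\ (K \ {insert b x}) ⊔ {insert b x, {b}}` (`|Y| = |K| + 1`,
`card_diffsY_of_singleton_mem`), so `K \ {insert b x}` is tight with every `k₂ \ x` among its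
differences, and the dual Lemma 3 of `MSTightLemma` produces a partner member inside `x` — which
`not_subset_x_of_mem_partner` excludes. Hence (`not_disjoint_of_mem_partner`) every partner
member meets `x`, and with `sdiff_mem_part0_of_not_mem_diffsY` and `eq_x_of_partnerless`
**`x` completes `F`** (`sdiff_mem_diffsY_of_mem_part0`).

**Main theorem** `unique_partnerless_and_completes_of_no_partner_pair`: under these hypotheses
`x` is the only member avoiding `r` without its `r`-partner, and `x \ s ∈ Y` for every `s ∈ F₀`
(so `F ∪ {insert r x}` is tight — the «tight minus a partner» shape of Addendum 23 §4).
Supplement 1 (`unique_partnerless_and_completes_of_no_partner_pair'`): at a `(K, P₁)` witness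
`s, insert b s` without `K`–`K` `b`-pairs every partnerless member `p` avoids `b` and has
`insert b p ∈ K` (`KP1.partnerless_witness`), so the same conclusion holds.
-/

namespace PercRepro.MSTight

open Finset
open scoped FinsetFamily

variable {α : Type*} [DecidableEq α] [Fintype α]

section Completion

variable {F : Finset (Finset α)} {r b : α} {x : Finset α}

namespace A26Data

/-- `{b}` is an `r`-only member of the trace: `{b} ∈ F₁`. -/
theorem singleton_b_mem_partr (hF : (F \\ F).card = F.card + 1) (hP : Tight (proj r F)) (hr : ({r} : Finset α) ∈ F)
    (hE : (∅ : Finset α) ∉ F) (hb0 : ({b} : Finset α) ∉ F) (hx0 : x ∈ part0 r F) (hx1 : x ∉ partr r F)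
    (hbx : b ∉ x) (hxb0 : insert b x ∈ part0 r F) (hxb1 : insert b x ∈ partr r F)
    (hL : ∀ e ∈ partner r F, insert b e ∉ partner r F) : ({b} : Finset α) ∈ partr r F := by
  have h0P : (∅ : Finset α) ∈ proj r F := by
    rw [proj_eq_union]; exact mem_union_right _ (empty_mem_partr hF hP hr hE hb0 hx0 hx1 hbx hxb0 hxb1 hL)
  rcases (pair_or hF hP hr hE hb0 hx0 hx1 hbx hxb0 hxb1 hL) h0P (notMem_empty b) (by simpa using (singleton_b_mem_proj hF hP hr hE hb0 hx0 hx1 hbx hxb0 hxb1 hL)) with h | h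
  · exact absurd (mem_part0.1 h.1).1 hE
  · simpa using h.2

/-- No partner member lies inside `x`. -/
theorem not_subset_x_of_mem_partner (hF : (F \\ F).card = F.card + 1) (hP : Tight (proj r F)) (hr : ({r} : Finset α) ∈ F)
    (hE : (∅ : Finset α) ∉ F) (hb0 : ({b} : Finset α) ∉ F) (hx0 : x ∈ part0 r F) (hx1 : x ∉ partr r F)
    (hbx : b ∉ x) (hxb0 : insert b x ∈ part0 r F) (hxb1 : insert b x ∈ partr r F)
    (hL : ∀ e ∈ partner r F, insert b e ∉ partner r F) {k : Finset α} (hk : k ∈ partner r F)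
    (hkx : Disjoint k x) {E : Finset α} (hEK : E ∈ partner r F) (hEx : E ⊆ x) : False := by
  have hbk : b ∉ k := by
    intro hbk
    rcases (partner_mem_b_cases hF hP hr hE hb0 hx0 hx1 hbx hxb0 hxb1 hL) hk hbk with h | ⟨-, -, hsub⟩
    · -- `insert b x` meets `x`
      apply (x_ne_empty hF hP hr hE hb0 hx0 hx1 hbx hxb0 hxb1 hL)
      rw [eq_empty_iff_forall_notMem]
      intro a ha
      exact Finset.disjoint_left.1 hkx (h ▸ mem_insert_of_mem ha) ha
    · -- `k.erase b ⊆ x` and `⊆ k` (it is `⊆ k` trivially): `k = {b}`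
      have hqe : k.erase b = ∅ := by
        rw [eq_empty_iff_forall_notMem]
        intro a ha
        exact Finset.disjoint_left.1 hkx (mem_of_mem_erase ha) (hsub x hx0 hbx ha)
      apply hb0
      have : k = {b} := by rw [← insert_erase hbk, hqe]; rfl
      exact this ▸ (mem_part0.1 (mem_inter.1 hk).1).1
  -- now the member `E ⊆ x`
  have hEne : E ≠ ∅ := fun h => hE (h ▸ (mem_part0.1 (mem_inter.1 hEK).1).1)
  have hbE : b ∉ E := fun h => hbx (hEx h)
  have hEP : E ∈ proj r F := by rw [proj_eq_union]; exact mem_union_left _ (mem_inter.1 hEK).1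
  have hEbP : insert b E ∈ proj r F := by
    have hxE : x \ E ∈ proj r F := sdiff_mem_proj_of_tight hP hr (x_mem_proj hF hP hr hE hb0 hx0 hx1 hbx hxb0 hxb1 hL) hEP
    have h := sdiff_mem_proj_of_tight hP hr (xb_mem_proj hF hP hr hE hb0 hx0 hx1 hbx hxb0 hxb1 hL) hxE
    have heq : insert b x \ (x \ E) = insert b E := by
      ext a
      simp only [mem_sdiff, mem_insert]
      constructor
      · rintro ⟨h1 | h1, h2⟩
        · exact Or.inl h1
        · right; by_contra h3; exact h2 ⟨h1, h3⟩
      · rintro (h1 | h1)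
        · exact ⟨Or.inl h1, fun h2 => hbx (h1 ▸ h2.1)⟩
        · exact ⟨Or.inr (hEx h1), fun h2 => h2.2 h1⟩
    rwa [heq] at h
  rcases (pair_or hF hP hr hE hb0 hx0 hx1 hbx hxb0 hxb1 hL) hEP hbE hEbP with h | h
  · -- `insert b E ∈ F₀`, not in `F₁` (`hL`), so it is `x` — but `b ∉ x`
    have h1 : insert b E ∉ partr r F := fun h1 => hL E hEK (mem_inter.2 ⟨h.2, h1⟩)
    have := (eq_x_of_partnerless hF hP hr hE hb0 hx0 hx1 hbx hxb0 hxb1 hL) h.2 h1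
    exact hbx (this ▸ mem_insert_self b E)
  · -- `E` and `insert b E` are `r`-lifted; with the disjoint `k`: `E ∈ Λ_b`, `E = ∅`
    have hEk : Disjoint E k := Finset.disjoint_of_subset_left hEx hkx.symm
    have h1 : E ∈ diffsY r F := by
      have h' := sdiff_mem_diffs h.1 (mem_inter.1 hk).1
      rwa [Finset.sdiff_eq_self_of_disjoint hEk] at h'
    have h2 : insert b E ∈ diffsY r F := by
      have h' := sdiff_mem_diffs h.2 (mem_inter.1 hk).1
      have hd : Disjoint (insert b E) k := by
        rw [Finset.disjoint_insert_left]; exact ⟨hbk, hEk⟩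
      rwa [Finset.sdiff_eq_self_of_disjoint hd] at h'
    exact hEne ((eq_empty_of_mem_lam hF hP hr hE hb0 hx0 hx1 hbx hxb0 hxb1 hL) h1 hbE h2)

/-- **Step (4).** Every partner member meets `x`. -/
theorem not_disjoint_of_mem_partner (hF : (F \\ F).card = F.card + 1) (hP : Tight (proj r F)) (hr : ({r} : Finset α) ∈ F)
    (hE : (∅ : Finset α) ∉ F) (hb0 : ({b} : Finset α) ∉ F) (hx0 : x ∈ part0 r F) (hx1 : x ∉ partr r F)
    (hbx : b ∉ x) (hxb0 : insert b x ∈ part0 r F) (hxb1 : insert b x ∈ partr r F)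
    (hL : ∀ e ∈ partner r F, insert b e ∉ partner r F) {k : Finset α} (hk : k ∈ partner r F) :
    ¬ Disjoint k x := by
  intro hkx
  have hbk : b ∉ k := by
    intro hbk
    rcases (partner_mem_b_cases hF hP hr hE hb0 hx0 hx1 hbx hxb0 hxb1 hL) hk hbk with h | ⟨-, -, hsub⟩
    · apply (x_ne_empty hF hP hr hE hb0 hx0 hx1 hbx hxb0 hxb1 hL)
      rw [eq_empty_iff_forall_notMem]
      intro a ha
      exact Finset.disjoint_left.1 hkx (h ▸ mem_insert_of_mem ha) ha
    · have hqe : k.erase b = ∅ := by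
        rw [eq_empty_iff_forall_notMem]
        intro a ha
        exact Finset.disjoint_left.1 hkx (mem_of_mem_erase ha) (hsub x hx0 hbx ha)
      apply hb0
      have : k = {b} := by rw [← insert_erase hbk, hqe]; rfl
      exact this ▸ (mem_part0.1 (mem_inter.1 hk).1).1
  -- `K_b = {insert b x}`: a partner member `k' ∋ b` other than `insert b x` would have
  -- `k'.erase b ⊆ x ∩ k = ∅`, i.e. `k' = {b}`
  have hKb : ∀ k' ∈ partner r F, b ∈ k' → k' = insert b x := by
    intro k' hk' hbk'
    rcases (partner_mem_b_cases hF hP hr hE hb0 hx0 hx1 hbx hxb0 hxb1 hL) hk' hbk' with h | ⟨-, -, hsub⟩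
    · exact h
    · exfalso
      have hqe : k'.erase b = ∅ := by
        rw [eq_empty_iff_forall_notMem]
        intro a ha
        exact Finset.disjoint_left.1 hkx (hsub k (mem_inter.1 hk).1 hbk ha) (hsub x hx0 hbx ha)
      apply hb0
      have : k' = {b} := by rw [← insert_erase hbk', hqe]; rfl
      exact this ▸ (mem_part0.1 (mem_inter.1 hk').1).1
  -- the count: `Y ⊇ D(K⁻) ⊔ {insert b x, {b}}` with `K⁻ = K \ {insert b x}`
  set Km := (partner r F).filter fun k => b ∉ k with hKm
  have hKmcard : Km.card + 1 = (partner r F).card := by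
    have h1 : (partner r F).filter (fun k => ¬ (b ∉ k)) = {insert b x} := by
      ext k'
      rw [mem_filter, mem_singleton]
      constructor
      · rintro ⟨hk', hbk'⟩
        exact hKb k' hk' (by simpa using hbk')
      · rintro rfl
        exact ⟨mem_inter.2 ⟨hxb0, hxb1⟩, by simp⟩
    have := card_filter_add_card_filter_not (s := partner r F) (fun k => b ∉ k)
    rw [h1, card_singleton] at this
    exact this
  have hsub : Km \\ Km ∪ {insert b x, {b}} ⊆ diffsY r F := by
    apply union_subset
    · intro d hd
      obtain ⟨k₁, hk₁, k₂, hk₂, rfl⟩ := Finset.mem_diffs.1 hd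
      exact sdiff_mem_diffs (mem_inter.1 (mem_filter.1 hk₁).1).2 (mem_inter.1 (mem_filter.1 hk₂).1).1
    · intro d hd
      rw [mem_insert, mem_singleton] at hd
      rcases hd with rfl | rfl
      · have h := sdiff_mem_diffs hxb1 (mem_inter.1 hk).1
        have hd : Disjoint (insert b x) k := by
          rw [Finset.disjoint_insert_left]; exact ⟨hbk, hkx.symm⟩
        rwa [Finset.sdiff_eq_self_of_disjoint hd] at h
      · have h := sdiff_mem_diffs (singleton_b_mem_partr hF hP hr hE hb0 hx0 hx1 hbx hxb0 hxb1 hL) (mem_inter.1 hk).1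
        rwa [Finset.sdiff_eq_self_of_disjoint (by simpa using hbk)] at h
  have hdisj : Disjoint (Km \\ Km) {insert b x, {b}} := by
    rw [Finset.disjoint_left]
    intro d hd hd'
    obtain ⟨k₁, hk₁, k₂, hk₂, rfl⟩ := Finset.mem_diffs.1 hd
    have hbd : b ∉ k₁ \ k₂ := fun h => (mem_filter.1 hk₁).2 (mem_sdiff.1 h).1
    rw [mem_insert, mem_singleton] at hd'
    rcases hd' with h | h
    · exact hbd (h ▸ mem_insert_self b x)
    · exact hbd (h ▸ mem_singleton_self b)
  have hcard2 : ({insert b x, {b}} : Finset (Finset α)).card = 2 := by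
    rw [card_insert_of_notMem, card_singleton]
    rw [mem_singleton]
    intro h
    apply (x_ne_empty hF hP hr hE hb0 hx0 hx1 hbx hxb0 hxb1 hL)
    rw [eq_empty_iff_forall_notMem]
    intro a ha
    have : a ∈ ({b} : Finset α) := h ▸ mem_insert_of_mem ha
    rw [mem_singleton] at this
    exact hbx (this ▸ ha)
  have hY := card_diffsY_of_singleton_mem hP hr hF
  have hMS := Finset.card_le_card_diffs Km
  have hle := card_le_card hsub
  rw [card_union_of_disjoint hdisj, hcard2] at hle
  have hKmt : (Km \\ Km).card = Km.card := by omega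
  have hYeq : diffsY r F = Km \\ Km ∪ {insert b x, {b}} := by
    symm; apply eq_of_subset_of_card_le hsub
    rw [card_union_of_disjoint hdisj, hcard2]; omega
  -- every `k₂ \ x` (`k₂ ∈ K⁻`) is a difference of `K⁻`
  have hdiff : ∀ E ∈ Km, E \ x ∈ Km \\ Km := by
    intro E hEm
    have h : E \ x ∈ diffsY r F := sdiff_mem_diffs (mem_inter.1 (mem_filter.1 hEm).1).2 hx0
    rw [hYeq, mem_union] at h
    rcases h with h | h
    · exact h
    · exfalso
      rw [mem_insert, mem_singleton] at h
      have hbE : b ∉ E \ x := fun h' => (mem_filter.1 hEm).2 (mem_sdiff.1 h').1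
      rcases h with h | h
      · exact hbE (h ▸ mem_insert_self b x)
      · exact hbE (h ▸ mem_singleton_self b)
  have hKmne : Km.Nonempty := ⟨k, mem_filter.2 ⟨hk, hbk⟩⟩
  obtain ⟨E, hEm, hEx⟩ := exists_subset_of_sdiff_mem univ Km x (fun E _ => subset_univ E)
    (subset_univ x) hKmne hKmt hdiff
  exact (not_subset_x_of_mem_partner hF hP hr hE hb0 hx0 hx1 hbx hxb0 hxb1 hL) hk hkx
    (mem_filter.1 hEm).1 hEx

/-- **Step (5).** `x` completes `F`: `x \ s ∈ Y` for every member `s` avoiding `r`. -/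
theorem sdiff_mem_diffsY_of_mem_part0 (hF : (F \\ F).card = F.card + 1) (hP : Tight (proj r F)) (hr : ({r} : Finset α) ∈ F)
    (hE : (∅ : Finset α) ∉ F) (hb0 : ({b} : Finset α) ∉ F) (hx0 : x ∈ part0 r F) (hx1 : x ∉ partr r F)
    (hbx : b ∉ x) (hxb0 : insert b x ∈ part0 r F) (hxb1 : insert b x ∈ partr r F)
    (hL : ∀ e ∈ partner r F, insert b e ∉ partner r F) {s : Finset α} (hs : s ∈ part0 r F) :
    x \ s ∈ diffsY r F := by
  by_cases hs1 : s ∈ partr r F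
  · by_cases hbs : b ∈ s
    · have h := sdiff_mem_diffs hxb1 hs
      rwa [Finset.insert_sdiff_of_mem x hbs] at h
    · by_contra hys
      obtain ⟨-, h0, h1, -⟩ := sdiff_mem_part0_of_not_mem_diffsY hF hP hr hx0 hx1 hbx
        hxb1 hs hys
      have hxs : x \ s = x := (eq_x_of_partnerless hF hP hr hE hb0 hx0 hx1 hbx hxb0 hxb1 hL) h0 h1
      have hd : Disjoint s x := by
        rw [Finset.disjoint_left]
        intro a has hax
        have : a ∈ x \ s := by rw [hxs]; exact hax
        exact (mem_sdiff.1 this).2 has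
      exact (not_disjoint_of_mem_partner hF hP hr hE hb0 hx0 hx1 hbx hxb0 hxb1 hL) (mem_inter.2 ⟨hs, hs1⟩) hd
  · rw [(eq_x_of_partnerless hF hP hr hE hb0 hx0 hx1 hbx hxb0 hxb1 hL) hs hs1, sdiff_self]
    have h := sdiff_mem_diffs (empty_mem_partr hF hP hr hE hb0 hx0 hx1 hbx hxb0 hxb1 hL) hx0
    rwa [Finset.empty_sdiff] at h

end A26Data

/-- **THEOREM (Addendum 26).** Let `F` have Marica–Schönheim excess one, `{r} ∈ F`, a tight trace
`proj r F`, `∅ ∉ F` and `{b} ∉ F`, and let `x, insert b x` be a `(P₀, K)` witness (`x ∈ F₀ \ F₁`,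
`insert b x ∈ K`) such that no partner member `e` has `insert b e` a partner member. Then `x` is
the only member avoiding `r` without its `r`-partner, and `x` completes `F`: `x \ s ∈ Y` for
every `s ∈ F₀` (so `F ∪ {insert r x}` is tight). -/
theorem unique_partnerless_and_completes_of_no_partner_pair (hF : (F \\ F).card = F.card + 1)
    (hP : Tight (proj r F)) (hr : ({r} : Finset α) ∈ F) (hE : (∅ : Finset α) ∉ F)
    (hb0 : ({b} : Finset α) ∉ F) (hx0 : x ∈ part0 r F) (hx1 : x ∉ partr r F) (hbx : b ∉ x)
    (hxbK : insert b x ∈ partner r F) (hL : ∀ e ∈ partner r F, insert b e ∉ partner r F) :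
    (∀ p ∈ part0 r F, p ∉ partr r F → p = x) ∧ ∀ s ∈ part0 r F, x \ s ∈ diffsY r F := by
  have hxb0 : insert b x ∈ part0 r F := (mem_inter.1 hxbK).1
  have hxb1 : insert b x ∈ partr r F := (mem_inter.1 hxbK).2
  exact ⟨fun p hp0 hp1 => A26Data.eq_x_of_partnerless hF hP hr hE hb0 hx0 hx1 hbx hxb0 hxb1 hL hp0 hp1,
    fun s hs => A26Data.sdiff_mem_diffsY_of_mem_part0 hF hP hr hE hb0 hx0 hx1 hbx hxb0 hxb1 hL hs⟩

end Completion

section KP1Witness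

variable {F : Finset (Finset α)} {r b : α} {s : Finset α}

namespace KP1

/-- At a `(K, P₁)` witness `s, insert b s` (`s ∈ K`, `insert b s ∈ F₁ \ F₀`) without `K`–`K`
`b`-pairs: a partnerless member `p ∋ b` has `s ⊆ p.erase b` and `p \ s` is again a partnerless
member containing `b`. -/
theorem aux (hF : (F \\ F).card = F.card + 1) (hP : Tight (proj r F)) (hr : ({r} : Finset α) ∈ F)
    (hE : (∅ : Finset α) ∉ F) (hb0 : ({b} : Finset α) ∉ F) (hs0 : s ∈ part0 r F)
    (hs1 : s ∈ partr r F) (hbs : b ∉ s) (hsb1 : insert b s ∈ partr r F)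
    (hsb0 : insert b s ∉ part0 r F) (hL : ∀ e ∈ partner r F, insert b e ∉ partner r F)
    {p : Finset α} (hp0 : p ∈ part0 r F) (hp1 : p ∉ partr r F) (hbp : b ∈ p) :
    s ⊆ p.erase b ∧ p \ s ∈ part0 r F ∧ p \ s ∉ partr r F ∧ b ∈ p \ s := by
  have hwit : ¬ (s ∈ partr r F ∧ insert b s ∈ part0 r F) := fun h => hsb0 h.2
  have hlam := lam_eq_singleton_empty_of_no_partner_pair hF hP hr hs0 hbs hsb1 hL
  have hΛ : ∀ {y : Finset α}, y ∈ diffsY r F → b ∉ y → insert b y ∈ diffsY r F → y = ∅ := by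
    intro y hy hby hyb
    have : y ∈ ((diffsY r F).filter fun y => b ∉ y ∧ insert b y ∈ diffsY r F) :=
      mem_filter.2 ⟨hy, hby, hyb⟩
    rw [hlam, mem_singleton] at this
    exact this
  have hsP : s ∈ proj r F := by rw [proj_eq_union]; exact mem_union_left _ hs0
  have hsbP : insert b s ∈ proj r F := by rw [proj_eq_union]; exact mem_union_right _ hsb1
  have hbP : ({b} : Finset α) ∈ proj r F := by
    have h := sdiff_mem_proj_of_tight hP hr hsbP hsP
    rwa [Finset.insert_sdiff_of_notMem s hbs, sdiff_self] at h
  set q := p.erase b with hq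
  have hpq : p = insert b q := (insert_erase hbp).symm
  have hpP : p ∈ proj r F := by rw [proj_eq_union]; exact mem_union_left _ hp0
  have hqP : q ∈ proj r F := by
    have h := sdiff_mem_proj_of_tight hP hr hpP hbP
    rwa [sdiff_singleton_eq_erase] at h
  have hbq : b ∉ q := notMem_erase b p
  have hq1 : q ∈ partr r F := by
    rcases mem_partr_or_insert_mem_partr_of_witness hF hP hr hE hb0 hs0 hbs hsb1 hwit hqP hbq
      with h | h
    · exact h
    · exact absurd (hpq ▸ h) hp1
  have hq0 : q ∈ part0 r F := by
    rcases pair_mem_part0_or_partr_of_witness hF hP hr hs0 hbs hsb1 hwit hqP hbq (hpq ▸ hpP)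
      with h | h
    · exact h.1
    · exact absurd (hpq ▸ h.2) hp1
  -- `s ⊆ q`
  have hsq : s ⊆ q := by
    have h1 : insert b s \ q ∈ diffsY r F := sdiff_mem_diffs hsb1 hq0
    rw [Finset.insert_sdiff_of_notMem s hbq] at h1
    have h2 : insert b s \ p ∈ diffsY r F := sdiff_mem_diffs hsb1 hp0
    rw [hpq, insert_sdiff_insert_of_notMem hbs] at h2
    exact sdiff_eq_empty_iff_subset.1 (hΛ h2 (fun h => hbs (mem_sdiff.1 h).1) h1)
  have hsq' : s ≠ q := fun h => hsb0 (by rw [hpq, ← h] at hp0; exact hp0)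
  have hqs : q \ s ∈ diffsY r F := sdiff_mem_diffs hq1 hs0
  have hqsne : q \ s ≠ ∅ := fun h =>
    hsq' (Finset.Subset.antisymm hsq (sdiff_eq_empty_iff_subset.1 h))
  have hps_eq : p \ s = insert b (q \ s) := by
    rw [hpq, Finset.insert_sdiff_of_notMem q hbs]
  have hpsY : p \ s ∉ diffsY r F := by
    intro h
    rw [hps_eq] at h
    exact hqsne (hΛ hqs (fun h' => hbq (mem_sdiff.1 h').1) h)
  have hqsP : q \ s ∈ proj r F := sdiff_mem_proj_of_tight hP hr hqP hsP
  have hpsP : p \ s ∈ proj r F := sdiff_mem_proj_of_tight hP hr hpP hsP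
  have hps1 : p \ s ∉ partr r F := by
    intro h
    apply hpsY
    have h' := sdiff_mem_diffs h hs0
    have hss : (p \ s) \ s = p \ s := by ext a; simp only [mem_sdiff]; tauto
    rwa [hss] at h'
  have hps0 : p \ s ∈ part0 r F := by
    rcases pair_mem_part0_or_partr_of_witness hF hP hr hs0 hbs hsb1 hwit hqsP
      (fun h => hbq (mem_sdiff.1 h).1) (hps_eq ▸ hpsP) with h | h
    · rw [hps_eq]; exact h.2
    · exact absurd (hps_eq ▸ h.2) hps1
  exact ⟨hsq, hps0, hps1, mem_sdiff.2 ⟨hbp, hbs⟩⟩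

/-- At a `(K, P₁)` witness without `K`–`K` `b`-pairs, every partnerless member `p` avoids `b`
and has `insert b p ∈ K` — so `(p, insert b p)` is a `(P₀, K)` witness in the same direction. -/
theorem partnerless_witness (hF : (F \\ F).card = F.card + 1) (hP : Tight (proj r F))
    (hr : ({r} : Finset α) ∈ F) (hE : (∅ : Finset α) ∉ F) (hb0 : ({b} : Finset α) ∉ F)
    (hs0 : s ∈ part0 r F) (hs1 : s ∈ partr r F) (hbs : b ∉ s) (hsb1 : insert b s ∈ partr r F)
    (hsb0 : insert b s ∉ part0 r F) (hL : ∀ e ∈ partner r F, insert b e ∉ partner r F)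
    {p : Finset α} (hp0 : p ∈ part0 r F) (hp1 : p ∉ partr r F) :
    b ∉ p ∧ insert b p ∈ partner r F := by
  have hwit : ¬ (s ∈ partr r F ∧ insert b s ∈ part0 r F) := fun h => hsb0 h.2
  have hbp : b ∉ p := by
    intro hbp
    obtain ⟨hsq, hps0, hps1, hbps⟩ := aux hF hP hr hE hb0 hs0 hs1 hbs hsb1 hsb0 hL hp0 hp1 hbp
    obtain ⟨hsq', -, -, -⟩ := aux hF hP hr hE hb0 hs0 hs1 hbs hsb1 hsb0 hL hps0 hps1 hbps
    have : s ⊆ p \ s := hsq'.trans (erase_subset b _)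
    apply hE
    have hse : s = ∅ := by
      rw [eq_empty_iff_forall_notMem]
      intro a ha
      exact (mem_sdiff.1 (this ha)).2 ha
    exact hse ▸ (mem_part0.1 hs0).1
  have hpP : p ∈ proj r F := by rw [proj_eq_union]; exact mem_union_left _ hp0
  have hpb1 : insert b p ∈ partr r F := by
    rcases mem_partr_or_insert_mem_partr_of_witness hF hP hr hE hb0 hs0 hbs hsb1 hwit hpP hbp
      with h | h
    · exact absurd h hp1
    · exact h
  have hpbP : insert b p ∈ proj r F := by rw [proj_eq_union]; exact mem_union_right _ hpb1
  have hpb0 : insert b p ∈ part0 r F := by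
    rcases pair_mem_part0_or_partr_of_witness hF hP hr hs0 hbs hsb1 hwit hpP hbp hpbP with h | h
    · exact h.2
    · exact absurd h.1 hp1
  exact ⟨hbp, mem_inter.2 ⟨hpb0, hpb1⟩⟩

end KP1

/-- **THEOREM (Addendum 26, supplement 1).** At a `(K, P₁)` witness `s, insert b s` of an
excess-one family with `{r} ∈ F`, tight trace, `∅ ∉ F`, `{b} ∉ F` and no `K`–`K` `b`-pair, any two
members avoiding `r` without their `r`-partner coincide, and every such member completes `F`. -/
theorem unique_partnerless_and_completes_of_no_partner_pair' (hF : (F \\ F).card = F.card + 1)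
    (hP : Tight (proj r F)) (hr : ({r} : Finset α) ∈ F) (hE : (∅ : Finset α) ∉ F)
    (hb0 : ({b} : Finset α) ∉ F) (hs0 : s ∈ part0 r F) (hs1 : s ∈ partr r F) (hbs : b ∉ s)
    (hsb1 : insert b s ∈ partr r F) (hsb0 : insert b s ∉ part0 r F)
    (hL : ∀ e ∈ partner r F, insert b e ∉ partner r F) {p : Finset α} (hp0 : p ∈ part0 r F)
    (hp1 : p ∉ partr r F) :
    (∀ p' ∈ part0 r F, p' ∉ partr r F → p' = p) ∧ ∀ s' ∈ part0 r F, p \ s' ∈ diffsY r F := by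
  obtain ⟨hbp, hpbK⟩ := KP1.partnerless_witness hF hP hr hE hb0 hs0 hs1 hbs hsb1 hsb0 hL hp0 hp1
  exact unique_partnerless_and_completes_of_no_partner_pair hF hP hr hE hb0 hp0 hp1 hbp hpbK hL

end KP1Witness

end PercRepro.MSTight
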